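import Summits.ABC.StewartYu.PadicTwoFunctions
import HarnessLib

/-!
# Cell abc-stewartyu, Gen-3 frame at `p = 2` (crux `Y07Two`, stmt-ABC-19659), layer F1: the EXPONENT KERNEL on
# the M2 set-up — signed exponent vectors, the `b`-eliminated exponent, directional scalars, values at the
# integer points of both signs, the `f − φ` comparison, the derivative

`Summits/ABC/StewartYu/PadicG3TwoExpo.lean` — cell `abc-stewartyu` (HOME `run/shared/lean/pub/abc-stewartyu/`),
route `PadicPrimesKummerThird`, seat p3 (g5), F-two LEAD (layer plan HOME/p3/memo-09 §3).  Definitions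
(functions of the M2 datum `TwoSetup`) and theorems; no structure, no named fact.

ARCHITECTURAL POINT (memo-09 §3): the Gen-3 `2`-adic frame needs NO new set-up.  The M2 datum
`Summit.ABC.StewartYu.TwoSetup` (lit, `PadicTwoSetup.lean`: `d` free generators `αⱼ` and the eliminated `θ`,
all `≡ 1 (mod 8)`, coefficients `bⱼ`, `b_θ ≠ 0` of minimal `2`-adic order) already carries Baker–Wüstholz's
`b`-ELIMINATION (Yu 2013 (5.7) `Mᵢ = Lᵢ − (∂Lᵢ/∂zₙ/bₙ)·L`): `Λ₀ = ∑ βⱼ lg j − lgθ`, `βⱼ = −bⱼ/b_θ`.  What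
the Gen-3 frame adds at this level is only SIGNED data — exponent vectors `(u, u_θ) ∈ ℤᵈ × ℤ` (Nesterenko's
shifted box `𝐥 − 𝐯`, Yu's `µ − µ⁽⁰⁾`) and integer points `x` of both signs (Yu evaluates at `|s| ≤ S`; the
zero estimate's END `GenThreeFrameSpecTwo.FrameOutputTwo` wants `|x| ≤ (n+1)X`):

* `zψ u uθ = ∑ uⱼ lg j + u_θ lgθ` (exact exponent: `exp(x·zψ) = ∏ αⱼ^{uⱼx}·θ^{u_θ x}`, `exp_intCast_mul_zψ`),
  `zγ u uθ j = uⱼ + βⱼ u_θ ∈ ℚ` (`‖·‖₂ ≤ 1`), `zexpo u uθ = ∑ zγⱼ · lg j` (the `b`-eliminated exponent of the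
  analytic function `f`), `zexpo_eq : zexpo = zψ + u_θ·Λ₀`;
* the DIRECTIONAL SCALARS `dirScalar u uθ j = b_θ uⱼ − bⱼ u_θ ∈ ℤ` with `b_θ · zγⱼ = dirScalar`
  (`bθ_mul_zγ`) — so `d/dz exp(z·zexpo) = zexpo·exp(z·zexpo)` (`hasDerivAt_exp_mul_zexpo`, on `‖z‖ < 4`)
  has coefficient `zexpo = b_θ⁻¹ · ∑ⱼ dirScalarⱼ · lg j` (`zexpo_eq_dirScalar`): differentiating the analytic
  function produces exactly the moments of the `b`-eliminated directional scalars that the zero estimate's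
  END consumes (`GenThreeEndBridgeTwo`, pivot `j₀ = θ`);
* norms `‖zψ‖, ‖zexpo‖ ≤ 8⁻¹`; `‖exp(x·zexpo)‖ = 1`; the `f − φ` COMPARISON (Yu 2013 Lemma 5.1, M2
  `norm_F_sub_Φ_le` pattern): `‖exp(x·zexpo) − exp(x·zψ)‖ ≤ ‖Λ₀‖` (`norm_exp_zexpo_sub_exp_zψ_le`) — under the
  negated bound `‖Λ₀‖ ≤ 2^{−U}`, so the analytic function and the algebraic values agree to order `U`.

WHAT THIS IS NOT: no box, no auxiliary polynomial, no extrapolation; no crux moves.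

References: K. Yu, Acta Math. 211 (2013), (5.7)–(5.12), Lemma 5.1; P. L. Cijsouw, M. Waldschmidt, Compositio
Math. 34 (1977) §4 (the perturbed exponent); Yu 1990 §1.1 (`p = 2`).
-/

noncomputable section

open NormedSpace Finset IsUltrametricDist
open Literature.NumberTheory.Transcendental

namespace Summit.ABC.StewartYu

namespace TwoSetup

variable (S : TwoSetup)

/-! ### Signed exponent vectors: exact and `b`-eliminated exponents, directional scalars -/

/-- The EXACT exponent `zψ(u, u_θ) = ∑ⱼ uⱼ·lg j + u_θ·lgθ ∈ ℚ₂` of the monomial `∏ αⱼ^{uⱼ}·θ^{u_θ}`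
(signed exponents). [cite: Yu2013, (5.8)] -/
def zψ (u : Fin S.d → ℤ) (uθ : ℤ) : ℚ_[2] := ∑ j, (u j : ℚ_[2]) * S.lg j + (uθ : ℚ_[2]) * S.lgθ

/-- The eliminated coefficient `zγⱼ(u, u_θ) = uⱼ + βⱼ·u_θ ∈ ℚ` (`βⱼ = −bⱼ/b_θ`). [cite: Yu2013, (5.7)] -/
def zγ (u : Fin S.d → ℤ) (uθ : ℤ) (j : Fin S.d) : ℚ := (u j : ℚ) + S.frame.β j * uθ

/-- The `b`-ELIMINATED exponent `zexpo(u, u_θ) = ∑ⱼ zγⱼ·lg j` of the analytic function `f`.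
[cite: Yu2013, (5.9)] -/
def zexpo (u : Fin S.d → ℤ) (uθ : ℤ) : ℚ_[2] := ∑ j, (S.zγ u uθ j : ℚ_[2]) * S.lg j

/-- The DIRECTIONAL SCALAR `𝔛ⱼ(u, u_θ) = b_θ·uⱼ − bⱼ·u_θ ∈ ℤ` (pivot `θ`). [cite: Nesterenko2003, §3.5 (p. 68)] -/
def dirScalar (u : Fin S.d → ℤ) (uθ : ℤ) (j : Fin S.d) : ℤ := S.bθ * u j - S.b j * uθ

/-- `b_θ · zγⱼ = 𝔛ⱼ`. [folklore] -/
theorem bθ_mul_zγ (u : Fin S.d → ℤ) (uθ : ℤ) (j : Fin S.d) :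
    (S.bθ : ℚ) * S.zγ u uθ j = (S.dirScalar u uθ j : ℚ) := by
  have hb : (S.bθ : ℚ) ≠ 0 := by exact_mod_cast S.bθ_ne
  unfold zγ dirScalar
  rw [show S.frame.β j = -(S.b j : ℚ) / S.bθ from rfl]
  push_cast
  field_simp
  ring

/-- **The `b`-elimination identity**: `zexpo = zψ + u_θ·Λ₀`. [cite: CijsouwWaldschmidt1977, §4 (p. 184)] -/
theorem zexpo_eq (u : Fin S.d → ℤ) (uθ : ℤ) : S.zexpo u uθ = S.zψ u uθ + (uθ : ℚ_[2]) * S.Λ₀ := by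
  unfold zexpo zψ Λ₀ zγ
  push_cast
  simp only [add_mul, sum_add_distrib, mul_sum, mul_sub]
  have e : ∑ x, (S.frame.β x : ℚ_[2]) * (uθ : ℚ_[2]) * S.lg x = ∑ x, (uθ : ℚ_[2]) * ((S.frame.β x : ℚ_[2]) * S.lg x) :=
    Finset.sum_congr rfl fun x _ => by ring
  rw [e]
  ring

/-- **The derivative coefficient in directional form**: `zexpo = b_θ⁻¹ · ∑ⱼ 𝔛ⱼ · lg j`.
[cite: Nesterenko2003, §3.5 (p. 68)] -/
theorem zexpo_eq_dirScalar (u : Fin S.d → ℤ) (uθ : ℤ) :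
    S.zexpo u uθ = ((S.bθ : ℚ_[2]))⁻¹ * ∑ j, (S.dirScalar u uθ j : ℚ_[2]) * S.lg j := by
  have hb : (S.bθ : ℚ_[2]) ≠ 0 := by exact_mod_cast S.bθ_ne
  unfold zexpo
  rw [Finset.mul_sum]
  refine Finset.sum_congr rfl fun j _ => ?_
  have h := S.bθ_mul_zγ u uθ j
  have h' : (S.zγ u uθ j : ℚ_[2]) = ((S.bθ : ℚ_[2]))⁻¹ * (S.dirScalar u uθ j : ℚ_[2]) := by
    have h2 : ((S.bθ : ℚ) : ℚ_[2]) * ((S.zγ u uθ j : ℚ) : ℚ_[2]) = ((S.dirScalar u uθ j : ℚ) : ℚ_[2]) := by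
      rw [← Rat.cast_mul, h]
    push_cast at h2
    rw [← h2, ← mul_assoc, inv_mul_cancel₀ hb, one_mul]
  rw [h', mul_assoc]

/-! ### Norms -/

/-- `‖zγⱼ‖₂ ≤ 1` (`ord₂ b_θ` minimal). [cite: Yu1990, Theorem 2.1 (2.17)] -/
theorem norm_zγ_le (u : Fin S.d → ℤ) (uθ : ℤ) (j : Fin S.d) : ‖(S.zγ u uθ j : ℚ_[2])‖ ≤ 1 := by
  unfold zγ; push_cast
  refine (norm_add_le_max _ _).trans (max_le ?_ ?_)
  · exact_mod_cast Padic.norm_int_le_one (p := 2) (u j)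
  · rw [norm_mul]
    refine mul_le_one₀ (S.norm_β_le j) (norm_nonneg _) ?_
    exact_mod_cast Padic.norm_int_le_one (p := 2) uθ

/-- `‖zψ‖ ≤ 8⁻¹`. [cite: Yu1990, §1.1] -/
theorem norm_zψ_le (u : Fin S.d → ℤ) (uθ : ℤ) : ‖S.zψ u uθ‖ ≤ (8 : ℝ)⁻¹ := by
  unfold zψ
  refine (norm_add_le_max _ _).trans (max_le ?_ ?_)
  · refine IsUltrametricDist.norm_sum_le_of_forall_le_of_nonneg eighth_nonneg fun j _ => ?_
    rw [norm_mul]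
    refine (mul_le_of_le_one_left (norm_nonneg _) ?_).trans (S.norm_lg_le j)
    exact_mod_cast Padic.norm_int_le_one (p := 2) (u j)
  · rw [norm_mul]
    refine (mul_le_of_le_one_left (norm_nonneg _) ?_).trans S.norm_lgθ_le
    exact_mod_cast Padic.norm_int_le_one (p := 2) uθ

/-- `‖zexpo‖ ≤ 8⁻¹`. [cite: Yu1990, §1.1] -/
theorem norm_zexpo_le (u : Fin S.d → ℤ) (uθ : ℤ) : ‖S.zexpo u uθ‖ ≤ (8 : ℝ)⁻¹ := by
  unfold zexpo
  refine IsUltrametricDist.norm_sum_le_of_forall_le_of_nonneg eighth_nonneg fun j _ => ?_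
  rw [norm_mul]
  exact (mul_le_of_le_one_left (norm_nonneg _) (S.norm_zγ_le u uθ j)).trans (S.norm_lg_le j)

/-- `‖Λ₀‖ ≤ 8⁻¹`. [cite: Yu1990, §1.1] -/
theorem norm_Λ₀_le : ‖S.Λ₀‖ ≤ (8 : ℝ)⁻¹ := by
  unfold Λ₀
  rw [sub_eq_add_neg]
  refine (norm_add_le_max _ _).trans (max_le ?_ ?_)
  · refine IsUltrametricDist.norm_sum_le_of_forall_le_of_nonneg eighth_nonneg fun j _ => ?_
    rw [norm_mul]
    exact (mul_le_of_le_one_left (norm_nonneg _) (S.norm_β_le j)).trans (S.norm_lg_le j)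
  · rw [norm_neg]; exact S.norm_lgθ_le

/-- `‖x · c‖ < 2⁻¹` for an integer `x` and `‖c‖ ≤ 8⁻¹`. [folklore] -/
theorem norm_intCast_mul_lt_half (x : ℤ) {c : ℚ_[2]} (hc : ‖c‖ ≤ (8 : ℝ)⁻¹) :
    ‖(x : ℚ_[2]) * c‖ < ((2 : ℕ) : ℝ)⁻¹ := by
  rw [norm_mul]
  refine (mul_le_of_le_one_left (norm_nonneg _) ?_).trans_lt (hc.trans_lt eighth_lt_half)
  exact_mod_cast Padic.norm_int_le_one (p := 2) x

/-! ### Values at the integer points of both signs -/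

/-- **`exp(x·zψ) = ∏ⱼ αⱼ^{uⱼx} · θ^{u_θ x}`** for every integer `x`. [cite: Koblitz1984, Ch. IV §2] -/
theorem exp_intCast_mul_zψ (u : Fin S.d → ℤ) (uθ : ℤ) (x : ℤ) :
    exp ((x : ℚ_[2]) * S.zψ u uθ) =
      (∏ j, (S.α j : ℚ_[2]) ^ (u j * x)) * (S.θ : ℚ_[2]) ^ (uθ * x) := by
  -- write `x · zψ` as `∑ᵢ zᵢ · plog ωᵢ` over all `d + 1` generators
  set z : Fin (S.d + 1) → ℤ := Fin.snoc (fun j => u j * x) (uθ * x) with hz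
  have e : (x : ℚ_[2]) * S.zψ u uθ = ∑ i : Fin (S.d + 1), (z i : ℚ_[2]) * PadicExp.plog (S.ω i) := by
    unfold zψ lg lgθ lgAll
    rw [Fin.sum_univ_castSucc]
    simp only [hz, Fin.snoc_castSucc, Fin.snoc_last]
    push_cast
    rw [mul_add, Finset.mul_sum]
    congr 1
    · exact Finset.sum_congr rfl fun j _ => by ring
    · ring
  rw [e, PadicExp.exp_sum_intCast_mul_plog (ℓ := 2) univ _ _ fun i _ => S.norm_one_sub_ω_lt i]
  unfold ω SetupQ.all
  rw [Fin.prod_univ_castSucc]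
  simp only [hz, Fin.snoc_castSucc, Fin.snoc_last]

/-- `‖exp(x·zexpo)‖ = 1`. [cite: Yu1990, §1.1] -/
theorem norm_exp_intCast_mul_zexpo (u : Fin S.d → ℤ) (uθ : ℤ) (x : ℤ) :
    ‖exp ((x : ℚ_[2]) * S.zexpo u uθ)‖ = 1 :=
  PadicExp.norm_exp (ℓ := 2) (norm_intCast_mul_lt_half x (S.norm_zexpo_le u uθ))

/-- `‖exp(x·zψ)‖ = 1`. [cite: Yu1990, §1.1] -/
theorem norm_exp_intCast_mul_zψ (u : Fin S.d → ℤ) (uθ : ℤ) (x : ℤ) :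
    ‖exp ((x : ℚ_[2]) * S.zψ u uθ)‖ = 1 :=
  PadicExp.norm_exp (ℓ := 2) (norm_intCast_mul_lt_half x (S.norm_zψ_le u uθ))

/-- **The `f − φ` comparison (Yu 2013, Lemma 5.1) at one monomial**:
`‖exp(x·zexpo) − exp(x·zψ)‖ ≤ ‖Λ₀‖` (`= ‖x u_θ Λ₀‖ ≤ ‖Λ₀‖`). [cite: Yu2013, Lemma 5.1] -/
theorem norm_exp_zexpo_sub_exp_zψ_le (u : Fin S.d → ℤ) (uθ : ℤ) (x : ℤ) :
    ‖exp ((x : ℚ_[2]) * S.zexpo u uθ) - exp ((x : ℚ_[2]) * S.zψ u uθ)‖ ≤ ‖S.Λ₀‖ := by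
  have hψ : ‖(x : ℚ_[2]) * S.zψ u uθ‖ < ((2 : ℕ) : ℝ)⁻¹ :=
    norm_intCast_mul_lt_half x (S.norm_zψ_le u uθ)
  have hδ : ‖((x * uθ : ℤ) : ℚ_[2]) * S.Λ₀‖ < ((2 : ℕ) : ℝ)⁻¹ :=
    norm_intCast_mul_lt_half _ S.norm_Λ₀_le
  have hsplit : (x : ℚ_[2]) * S.zexpo u uθ = (x : ℚ_[2]) * S.zψ u uθ + ((x * uθ : ℤ) : ℚ_[2]) * S.Λ₀ := by
    rw [S.zexpo_eq]; push_cast; ring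
  rw [hsplit, PadicExp.exp_add (ℓ := 2) hψ hδ]
  have e : exp ((x : ℚ_[2]) * S.zψ u uθ) * exp (((x * uθ : ℤ) : ℚ_[2]) * S.Λ₀) -
      exp ((x : ℚ_[2]) * S.zψ u uθ) =
      exp ((x : ℚ_[2]) * S.zψ u uθ) * (exp (((x * uθ : ℤ) : ℚ_[2]) * S.Λ₀) - 1) := by ring
  rw [e, norm_mul, S.norm_exp_intCast_mul_zψ, one_mul, PadicExp.norm_exp_sub_one (ℓ := 2) hδ, norm_mul]
  refine mul_le_of_le_one_left (norm_nonneg _) ?_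
  exact_mod_cast Padic.norm_int_le_one (p := 2) (x * uθ)

/-! ### The derivative -/

/-- **`d/dz exp(z·zexpo) = zexpo · exp(z·zexpo)`** on `‖z‖ < 4` — with `zexpo = b_θ⁻¹·∑ 𝔛ⱼ lg j`
(`zexpo_eq_dirScalar`) this is the source of the directional moments. [cite: Yu1990, §1.1] -/
theorem hasDerivAt_exp_mul_zexpo (u : Fin S.d → ℤ) (uθ : ℤ) {z : ℚ_[2]} (hz : ‖z‖ < 4) :
    HasDerivAt (fun w : ℚ_[2] => exp (S.zexpo u uθ * w))
      (S.zexpo u uθ * exp (S.zexpo u uθ * z)) z :=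
  hasDerivAt_exp_mul (S.norm_zexpo_le u uθ) hz

/-- The analytic function `z ↦ exp(z·zexpo)` is analytic at every `‖z‖ < 4`. [cite: Yu1990, §1.1] -/
theorem analyticAt_exp_mul_zexpo (u : Fin S.d → ℤ) (uθ : ℤ) {z : ℚ_[2]} (hz : ‖z‖ < 4) :
    AnalyticAt ℚ_[2] (fun w : ℚ_[2] => exp (S.zexpo u uθ * w)) z :=
  analyticAt_exp_mul (S.norm_zexpo_le u uθ) hz

/-! ### The monomial value as a rational number -/

/-- The rational monomial `zmon(u, u_θ, x) = ∏ⱼ αⱼ^{uⱼ x} · θ^{u_θ x} ∈ ℚ`. [cite: Yu2013, (4.16)] -/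
def zmon (u : Fin S.d → ℤ) (uθ : ℤ) (x : ℤ) : ℚ := (∏ j, S.α j ^ (u j * x)) * S.θ ^ (uθ * x)

/-- `exp(x·zψ) = zmon` read in `ℚ₂`. [cite: Koblitz1984, Ch. IV §2] -/
theorem exp_intCast_mul_zψ_eq_cast (u : Fin S.d → ℤ) (uθ : ℤ) (x : ℤ) :
    exp ((x : ℚ_[2]) * S.zψ u uθ) = (S.zmon u uθ x : ℚ_[2]) := by
  rw [S.exp_intCast_mul_zψ]; unfold zmon; push_cast; rfl

/-- `zmon ≠ 0`. [folklore] -/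
theorem zmon_ne_zero (u : Fin S.d → ℤ) (uθ : ℤ) (x : ℤ) : S.zmon u uθ x ≠ 0 := by
  unfold zmon
  exact mul_ne_zero (Finset.prod_ne_zero_iff.mpr fun j _ => zpow_ne_zero _ (S.α_ne j))
    (zpow_ne_zero _ S.θ_ne)

/-- `zmon(u, u_θ, x) = (∏ⱼ αⱼ^{uⱼ} · θ^{u_θ})ˣ` — the point `(x, αˣ)` of the zero estimate's END sees the
monomial `Y^{(u,u_θ)}`. [cite: Nesterenko2003, §5.1 (5.2)] -/
theorem zmon_eq_zpow (u : Fin S.d → ℤ) (uθ : ℤ) (x : ℤ) :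
    S.zmon u uθ x = ((∏ j, S.α j ^ u j) * S.θ ^ uθ) ^ x := by
  unfold zmon
  rw [mul_zpow, ← Finset.prod_zpow]
  congr 1
  · exact Finset.prod_congr rfl fun j _ => by rw [← zpow_mul]
  · rw [← zpow_mul]

end TwoSetup

end Summit.ABC.StewartYu

end
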